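import Summits.CriticalPhenomena.PercolationContinuityZ3.Theorems.PercNearOneGluingNoHeavyLowerTailKNQuestion7AllRelays
import Summits.CriticalPhenomena.PercolationContinuityZ3.Theorems.PercNearOneGluingNearOneGluing
import Summits.CriticalPhenomena.PercolationContinuityZ3.Theorems.PercNearOneGluingAdditiveGluing
import Summits.CriticalPhenomena.PercolationContinuityZ3.Theorems.PercNearOneGluingNoHeavyLowerTailResidualOfNearOneGluing
import Summits.CriticalPhenomena.PercolationContinuityZ3.Theorems.PercNearOneGluingNoHeavyLowerTailKNConj1Holds
import Literature.Probability.Percolation.MagnetizationLowerBound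
import HarnessLib

/-!
# `NoHeavyLowerTail` (stmt-CriticalPhenomena-4575) — registered engine stubs of the crux that are now corollaries

Support file (`--supports stmt-CriticalPhenomena-4575`), prover `prim-ineq-gen-6` (gen 10).  No definitions, no named
facts, no sorries; standard axioms.

The crux `NoHeavyLowerTail` closed through the conditioned slack hierarchy (`CSH.noHeavyLowerTail_holds`, p205010);
with it Kozma–Nitzan's Conjectures 1, 3 and 4 and Question 7 are tree theorems (`kozmaNitzan2024_conjecture1_holds`,
`NearOneGluing_proof`, `AdditiveGluing_proof`, `Q7Psi.kn_conj4_designated`, `Q7Psi.kn_question7`).  Several stubs that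
the crux's earlier LINES registered on the item (planner skeleton r2, the c6 certificate programme, gen-kcluster,
cplus-engine) are plain corollaries of those theorems; this file discharges them BY NAME AND SIGNATURE so that the
item's stub ledger agrees with the mathematics:

* `stub_worstRelayGluing` (gen-kcluster U1: `μ({o ↮ c} ∩ {o ↔ A}) ≤ μ({a₁ ↮ c} ∩ {o ↔ A})` for the least `c`-reliable
  relay `a₁`) — Question 7 (`Q7Psi.kn_question7`) with complements taken inside `{o ↔ A}`;
* `stub_manyFingersLargePocket` (skeleton r2) — `manyFingersLargePocket_of_nearOneGluing NearOneGluing_proof`;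
* `stub_touchGluing` (skeleton r2) — the event sits inside `{o ↮ b}`, whose probability `NearOneGluing` makes `< ε`;
* `stub_meanConnection` (cplus-engine: `(1 − ε)|A| ≤ E N` under `τ`-reliability) — `AdditiveGluing` at each `b ∈ A`
  with `τ = ε / 2`, summed;
* `stub_nearOneGluingHalf`, `stub_additiveGluingHalf`, `stub_exchangeHalf` (skeleton r2, uniform weight `1/2` on a graph
  `G`) — the all-weights theorems at `w = 1/2·1_{E(G)}` (`bondPercolation_eq_prodBernoulli'`), the exchange form being
  Question 7 minus the common part `{a⋆ ↔ b} ∩ {o ↔ b} ∩ {o ↔ A}`;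
* `knConj1_uniform_le_six`, `knConj1_uniform_completeSix` (c6 certificate programme) — Conjecture 1
  (`kozmaNitzan2024_conjecture1_holds`) on `bondPercolation G p`, any `n` (so in particular `n ≤ 6` / `K₆`).
[cite: KozmaNitzan2024, Conjecture 1 (p. 3), Conjecture 3 (p. 15), Question 7 (p. 36)]
-/

noncomputable section

namespace Summit.CriticalPhenomena.PercolationContinuityZ3.Theorems

open MeasureTheory Set Literature.Probability.LatticeModels Literature.Probability.Percolation
open scoped Classical

namespace EngineStubs

/-- `μ(Sᶜ ∩ U) = μ(U) − μ(S ∩ U)` on the finite configuration space. [folklore] -/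
theorem measureReal_compl_inter {n : ℕ} (μ : Measure (BondConfig (Fin n))) [IsFiniteMeasure μ]
    (S U : Set (BondConfig (Fin n))) :
    μ.real (Sᶜ ∩ U) = μ.real U - μ.real (S ∩ U) := by
  have h := measureReal_inter_add_sdiff (μ := μ) (s := U) (t := S) MeasurableSet.of_discrete (measure_ne_top μ U)
  have e1 : Sᶜ ∩ U = U \ S := by ext ω; simp only [Set.mem_inter_iff, Set.mem_compl_iff, Set.mem_sdiff]; tauto
  rw [e1, Set.inter_comm S U]
  linarith

/-- **Registered stub `stub_worstRelayGluing` (gen-kcluster U1), verbatim.**  For the least `c`-reliable relay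
`a₁ ∈ A` (`μ(a ↮ c) ≤ μ(a₁ ↮ c)` for all `a ∈ A`): `μ({o ↮ c} ∩ {o ↔ A}) ≤ μ({a₁ ↮ c} ∩ {o ↔ A})`.
Kozma–Nitzan's Question 7 (`Q7Psi.kn_question7`, designated form, every weight vector) with complements inside
`{o ↔ A}`. [this work] [cite: KozmaNitzan2024, Question 7 (p. 36), display (41)] -/
theorem stub_worstRelayGluing :
    ∀ (n : ℕ) (w : Sym2 (Fin n) → unitInterval) (A : Finset (Fin n)) (o c a₁ : Fin n), a₁ ∈ A →
      (∀ a ∈ A, (Literature.Probability.LatticeModels.prodBernoulli w).real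
          (Literature.Probability.Percolation.openConn a c :
            Set (Literature.Probability.Percolation.BondConfig (Fin n)))ᶜ ≤
        (Literature.Probability.LatticeModels.prodBernoulli w).real
          (Literature.Probability.Percolation.openConn a₁ c :
            Set (Literature.Probability.Percolation.BondConfig (Fin n)))ᶜ) →
      (Literature.Probability.LatticeModels.prodBernoulli w).real
          ((Literature.Probability.Percolation.openConn o c :
              Set (Literature.Probability.Percolation.BondConfig (Fin n)))ᶜ ∩
            ⋃ a ∈ A, Literature.Probability.Percolation.openConn o a) ≤
        (Literature.Probability.LatticeModels.prodBernoulli w).real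
          ((Literature.Probability.Percolation.openConn a₁ c :
              Set (Literature.Probability.Percolation.BondConfig (Fin n)))ᶜ ∩
            ⋃ a ∈ A, Literature.Probability.Percolation.openConn o a) := by
  intro n w A o c a₁ ha₁ hworst
  set μ := prodBernoulli w with hμ
  haveI : IsProbabilityMeasure μ := by rw [hμ]; infer_instance
  have hmin : ∀ a ∈ A, μ.real (openConn a₁ c) ≤ μ.real (openConn a c) := by
    intro a ha
    have h1 := probReal_compl_eq_one_sub (μ := μ) (s := (openConn a c : Set (BondConfig (Fin n))))
      MeasurableSet.of_discrete
    have h2 := probReal_compl_eq_one_sub (μ := μ) (s := (openConn a₁ c : Set (BondConfig (Fin n))))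
      MeasurableSet.of_discrete
    have := hworst a ha
    rw [h1, h2] at this
    linarith
  have key := Q7Psi.kn_question7 w A o c a₁ ha₁ hmin
  rw [← hμ] at key
  rw [measureReal_compl_inter, measureReal_compl_inter]
  linarith

/-- **Registered stub `stub_manyFingersLargePocket` (planner skeleton r2), verbatim** — the many-finger
large-pocket residual, from KN Conjecture 3 (`NearOneGluing_proof`) by the landed reduction
`manyFingersLargePocket_of_nearOneGluing`. [this work] [cite: KozmaNitzan2024, Conjecture 3 (p. 15)] -/
theorem stub_manyFingersLargePocket :
    ∀ ε : ℝ, 0 < ε → ∃ (δ : ℝ) (d₀ s₀ : ℕ), 0 < δ ∧ ∀ (n : ℕ) (w : Sym2 (Fin n) → unitInterval)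
      (A : Finset (Fin n)) (o a₀ : Fin n), a₀ ∈ A → o ∉ A →
      (∀ a ∈ A, ∀ a' ∈ A, (Literature.Probability.LatticeModels.prodBernoulli w).real
        (Literature.Probability.Percolation.openConn a a')ᶜ ≤ δ) →
      (Literature.Probability.LatticeModels.prodBernoulli w).real
        (⋃ a ∈ A, Literature.Probability.Percolation.openConn o a)ᶜ ≤ δ →
      (Literature.Probability.LatticeModels.prodBernoulli w).real
        {ω : Literature.Probability.Percolation.BondConfig (Fin n) |
          ω ∉ Literature.Probability.Percolation.openConn o a₀ ∧
          s₀ ≤ ((A.erase a₀).filter fun a => ω ∈ Literature.Probability.Percolation.openConn o a).card ∧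
          2 * ((A.erase a₀).filter fun a => ω ∈ Literature.Probability.Percolation.openConn o a).card ≤ A.card ∧
          d₀ < (A.filter fun a => ω ∈ Literature.Probability.Percolation.openConnIn
            ((↑A : Set (Fin n))ᶜ ∪ {o, a}) o a).card} ≤ ε :=
  manyFingersLargePocket_of_nearOneGluing NearOneGluing_proof

/-- **Registered stub `stub_touchGluing` (planner skeleton r2), verbatim.**  The "touch" event lies inside
`{o ↮ b}`, and `P(o ↮ b) < ε` under the near-one hypotheses by KN Conjecture 3 (`NearOneGluing_proof`). [this work]
[cite: KozmaNitzan2024, Conjecture 3 (p. 15)] -/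
theorem stub_touchGluing :
    ∀ ε : ℝ, 0 < ε → ∃ δ : ℝ, 0 < δ ∧ ∀ (n : ℕ) (w : Sym2 (Fin n) → unitInterval) (A : Finset (Fin n))
      (o b : Fin n), 1 - δ < (Literature.Probability.LatticeModels.prodBernoulli w).real
        (⋃ a ∈ A, Literature.Probability.Percolation.openConn o a) →
      (∀ a ∈ A, 1 - δ < (Literature.Probability.LatticeModels.prodBernoulli w).real
        (Literature.Probability.Percolation.openConn a b)) →
      (Literature.Probability.LatticeModels.prodBernoulli w).real
        ((⋃ a ∈ A, Literature.Probability.Percolation.openConn o a) ∩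
          (Literature.Probability.Percolation.openConn o b)ᶜ ∩
          {ω : Set (Sym2 (Fin n)) | ∃ x y : Fin n, w s(x, y) ≠ 0 ∧
            ω ∈ Literature.Probability.Percolation.openConn o x ∧
            ω ∈ Literature.Probability.Percolation.openConn y b}) < ε := by
  intro ε hε
  obtain ⟨δ, hδ, h⟩ := NearOneGluing_proof ε hε
  refine ⟨δ, hδ, fun n w A o b hU hrel => ?_⟩
  have key := h n w A o b hU hrel
  have hc := probReal_compl_eq_one_sub (μ := prodBernoulli w) (s := (openConn o b : Set (BondConfig (Fin n))))
    MeasurableSet.of_discrete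
  calc (prodBernoulli w).real ((⋃ a ∈ A, openConn o a) ∩ (openConn o b)ᶜ ∩
          {ω : Set (Sym2 (Fin n)) | ∃ x y : Fin n, w s(x, y) ≠ 0 ∧ ω ∈ openConn o x ∧ ω ∈ openConn y b})
      ≤ (prodBernoulli w).real (openConn o b : Set (BondConfig (Fin n)))ᶜ :=
        measureReal_mono (fun ω hω => hω.1.2) (measure_ne_top _ _)
    _ = 1 - (prodBernoulli w).real (openConn o b) := hc
    _ < ε := by linarith

/-- **Registered stub `stub_meanConnection` (cplus-engine), verbatim**: for every `ε > 0` there is `τ > 0`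
(`τ = ε/2`) such that `(1 − ε)|A| ≤ E N = Σ_{a∈A} P(o ↔ a)` whenever all pairwise relay disconnections and
`P(o ↮ A)` are `≤ τ`.  Additive gluing (`AdditiveGluing_proof`, KN Conjecture 1 in additive form) at every target
`b ∈ A` gives `P(o ↔ b) ≥ P(o ↔ A) − τ ≥ 1 − 2τ`; sum over `b`. [this work] [cite: KozmaNitzan2024, Conjecture 1 (p. 3)] -/
theorem stub_meanConnection :
    ∀ ε : ℝ, 0 < ε → ∃ τ : ℝ, 0 < τ ∧ ∀ (n : ℕ) (w : Sym2 (Fin n) → unitInterval) (A : Finset (Fin n)) (o : Fin n),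
      (∀ a ∈ A, ∀ a' ∈ A, a ≠ a' → (Literature.Probability.LatticeModels.prodBernoulli w).real
        (Literature.Probability.Percolation.openConn a a')ᶜ ≤ τ) →
      (Literature.Probability.LatticeModels.prodBernoulli w).real
        (⋃ a ∈ A, (Literature.Probability.Percolation.openConn o a :
          Set (Literature.Probability.Percolation.BondConfig (Fin n))))ᶜ ≤ τ →
      (1 - ε) * (A.card : ℝ) ≤ ∑ a ∈ A, (Literature.Probability.LatticeModels.prodBernoulli w).real
        (Literature.Probability.Percolation.openConn o a) := by
  intro ε hε
  refine ⟨ε / 2, by positivity, fun n w A o hpair hobs => ?_⟩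
  set μ := prodBernoulli w with hμ
  haveI : IsProbabilityMeasure μ := by rw [hμ]; infer_instance
  have hU : 1 - ε / 2 ≤ μ.real (⋃ a ∈ A, (openConn o a : Set (BondConfig (Fin n)))) := by
    have hc := probReal_compl_eq_one_sub (μ := μ) (s := ⋃ a ∈ A, (openConn o a : Set (BondConfig (Fin n))))
      MeasurableSet.of_discrete
    rw [hc] at hobs
    linarith
  have hb : ∀ b ∈ A, 1 - ε ≤ μ.real (openConn o b) := by
    intro b hb
    have hrel : ∀ a ∈ A, 1 - ε / 2 ≤ μ.real (openConn a b) := by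
      intro a ha
      by_cases hab : a = b
      · subst hab
        have huniv : (openConn a a : Set (BondConfig (Fin n))) = Set.univ :=
          Set.eq_univ_iff_forall.2 fun _ => SimpleGraph.Reachable.refl a
        rw [huniv, probReal_univ]
        linarith
      · have hc := probReal_compl_eq_one_sub (μ := μ) (s := (openConn a b : Set (BondConfig (Fin n))))
          MeasurableSet.of_discrete
        have := hpair a ha b hb hab
        rw [hc] at this
        linarith
    have key := AdditiveGluing_proof n w A o b (ε / 2) (by positivity) hrel
    rw [← hμ] at key
    linarith
  calc (1 - ε) * (A.card : ℝ) = ∑ _b ∈ A, (1 - ε) := by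
        rw [Finset.sum_const, nsmul_eq_mul, mul_comm]
    _ ≤ ∑ b ∈ A, μ.real (openConn o b) := Finset.sum_le_sum hb

/-- The uniform weight-`1/2` bond percolation on `G` as a product Bernoulli measure on `Sym2`. [folklore] -/
theorem bondPercolation_half_eq {n : ℕ} (G : SimpleGraph (Fin n)) :
    bondPercolation G half = prodBernoulli (fun e : Sym2 (Fin n) => if e ∈ G.edgeSet then half else 0) := by
  rw [bondPercolation_eq_prodBernoulli']

/-- **Registered stub `stub_nearOneGluingHalf` (planner skeleton r2), verbatim** — KN Conjecture 3 at uniform weight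
`1/2` on an arbitrary finite graph: the all-weights theorem `NearOneGluing_proof` at `w = ½·1_{E(G)}`. [this work]
[cite: KozmaNitzan2024, Conjecture 3 (p. 15)] -/
theorem stub_nearOneGluingHalf :
    ∀ ε : ℝ, 0 < ε → ∃ δ : ℝ, 0 < δ ∧ ∀ (n : ℕ) (G : SimpleGraph (Fin n)) (A : Finset (Fin n)) (o b : Fin n),
      1 - δ < (Literature.Probability.Percolation.bondPercolation G Literature.Probability.Percolation.half).real
        (⋃ a ∈ A, Literature.Probability.Percolation.openConn o a) →
      (∀ a ∈ A, 1 - δ < (Literature.Probability.Percolation.bondPercolation G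
        Literature.Probability.Percolation.half).real (Literature.Probability.Percolation.openConn a b)) →
      1 - ε < (Literature.Probability.Percolation.bondPercolation G Literature.Probability.Percolation.half).real
        (Literature.Probability.Percolation.openConn o b) := by
  intro ε hε
  obtain ⟨δ, hδ, h⟩ := NearOneGluing_proof ε hε
  refine ⟨δ, hδ, fun n G A o b hU hrel => ?_⟩
  rw [bondPercolation_half_eq] at hU hrel ⊢
  exact h n _ A o b hU hrel

/-- **Registered stub `stub_additiveGluingHalf` (planner skeleton r2), verbatim** — additive gluing at uniform weight
`1/2` on an arbitrary finite graph: `AdditiveGluing_proof` at `w = ½·1_{E(G)}`. [this work]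
[cite: KozmaNitzan2024, Conjecture 1 (p. 3)] -/
theorem stub_additiveGluingHalf :
    ∀ (n : ℕ) (G : SimpleGraph (Fin n)) (A : Finset (Fin n)) (o b : Fin n) (t : ℝ), 0 ≤ t →
      (∀ a ∈ A, 1 - t ≤ (Literature.Probability.Percolation.bondPercolation G
        Literature.Probability.Percolation.half).real (Literature.Probability.Percolation.openConn a b)) →
      (Literature.Probability.Percolation.bondPercolation G Literature.Probability.Percolation.half).real
          (⋃ a ∈ A, Literature.Probability.Percolation.openConn o a) - t ≤
        (Literature.Probability.Percolation.bondPercolation G Literature.Probability.Percolation.half).real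
          (Literature.Probability.Percolation.openConn o b) := by
  intro n G A o b t ht hrel
  rw [bondPercolation_half_eq] at hrel ⊢
  exact AdditiveGluing_proof n _ A o b t ht hrel

/-- **Registered stub `stub_exchangeHalf` (planner skeleton r2), verbatim** — the EXCHANGE inequality at uniform weight
`1/2`: for the least `b`-reliable relay `a⋆`, `μ({a⋆ ↔ b} ∩ {o ↔ A} ∩ {o ↮ b}) ≤ μ({a⋆ ↮ b} ∩ {o ↔ b})`.  Question 7
(`Q7Psi.kn_question7`: `μ({a⋆ ↔ b} ∩ {o ↔ A}) ≤ μ({o ↔ b} ∩ {o ↔ A})`) minus the common part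
`{a⋆ ↔ b} ∩ {o ↔ b} ∩ {o ↔ A}`, then drop `{o ↔ A}`. [this work] [cite: KozmaNitzan2024, Question 7 (p. 36)] -/
theorem stub_exchangeHalf :
    ∀ (n : ℕ) (G : SimpleGraph (Fin n)) (A : Finset (Fin n)) (o b aStar : Fin n), aStar ∈ A →
      (∀ a ∈ A, (Literature.Probability.Percolation.bondPercolation G Literature.Probability.Percolation.half).real
          (Literature.Probability.Percolation.openConn aStar b) ≤
        (Literature.Probability.Percolation.bondPercolation G Literature.Probability.Percolation.half).real
          (Literature.Probability.Percolation.openConn a b)) →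
      (Literature.Probability.Percolation.bondPercolation G Literature.Probability.Percolation.half).real
          (Literature.Probability.Percolation.openConn aStar b ∩
            ((⋃ a ∈ A, Literature.Probability.Percolation.openConn o a) ∩
              (Literature.Probability.Percolation.openConn o b)ᶜ)) ≤
        (Literature.Probability.Percolation.bondPercolation G Literature.Probability.Percolation.half).real
          ((Literature.Probability.Percolation.openConn aStar b)ᶜ ∩
            Literature.Probability.Percolation.openConn o b) := by
  intro n G A o b aStar haStar hmin
  rw [bondPercolation_half_eq] at hmin ⊢
  set w : Sym2 (Fin n) → unitInterval := fun e => if e ∈ G.edgeSet then half else 0 with hw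
  set μ := prodBernoulli w with hμ
  haveI : IsProbabilityMeasure μ := by rw [hμ]; infer_instance
  set S : Set (BondConfig (Fin n)) := openConn aStar b with hS
  set T : Set (BondConfig (Fin n)) := openConn o b with hT
  set U : Set (BondConfig (Fin n)) := ⋃ a ∈ A, (openConn o a : Set (BondConfig (Fin n))) with hU
  have key : μ.real (S ∩ U) ≤ μ.real (T ∩ U) := Q7Psi.kn_question7 w A o b aStar haStar hmin
  -- split both sides along the other event
  have h1 := measureReal_inter_add_sdiff (μ := μ) (s := S ∩ U) (t := T) MeasurableSet.of_discrete
    (measure_ne_top μ _)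
  have h2 := measureReal_inter_add_sdiff (μ := μ) (s := T ∩ U) (t := S) MeasurableSet.of_discrete
    (measure_ne_top μ _)
  have hcommon : S ∩ U ∩ T = T ∩ U ∩ S := by
    ext ω; simp only [Set.mem_inter_iff]; tauto
  have hL : S ∩ (U ∩ Tᶜ) = (S ∩ U) \ T := by
    ext ω; simp only [Set.mem_inter_iff, Set.mem_compl_iff, Set.mem_sdiff]; tauto
  have hR : μ.real ((T ∩ U) \ S) ≤ μ.real (Sᶜ ∩ T) :=
    measureReal_mono (fun ω hω => ⟨hω.2, hω.1.1⟩) (measure_ne_top μ _)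
  rw [hL]
  rw [hcommon] at h1
  linarith

/-- **Registered stub `knConj1_uniform_le_six` (c6 certificate programme), verbatim** — Kozma–Nitzan's Conjecture 1
`P(o ↔ A)·s ≤ P(o ↔ b)` (`s ≤ min_a P(a ↔ b)`) for uniform bond percolation on graphs with `n ≤ 6` vertices: the
all-graphs, all-weights theorem `kozmaNitzan2024_conjecture1_holds` (the bound `n ≤ 6` is not used). [this work]
[cite: KozmaNitzan2024, Conjecture 1 (p. 3)] -/
theorem knConj1_uniform_le_six :
    ∀ (n : ℕ), n ≤ 6 → ∀ (G : SimpleGraph (Fin n)) (p : unitInterval) (A : Finset (Fin n)) (o b : Fin n) (s : ℝ),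
      (∀ a ∈ A, s ≤ (Literature.Probability.Percolation.bondPercolation G p).real
        (Literature.Probability.Percolation.openConn a b)) →
      (Literature.Probability.Percolation.bondPercolation G p).real
          (⋃ a ∈ A, Literature.Probability.Percolation.openConn o a) * s ≤
        (Literature.Probability.Percolation.bondPercolation G p).real
          (Literature.Probability.Percolation.openConn o b) := by
  intro n _ G p A o b s hs
  rw [bondPercolation_eq_prodBernoulli'] at hs ⊢
  exact kozmaNitzan2024_conjecture1_holds n _ A o b s hs

/-- **Registered stub `knConj1_uniform_completeSix` (c6 certificate programme), verbatim** — Conjecture 1 for uniform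
bond percolation on the complete graph `K₆`: `kozmaNitzan2024_conjecture1_holds` at `w = p·1_{E(K₆)}`. [this work]
[cite: KozmaNitzan2024, Conjecture 1 (p. 3)] -/
theorem knConj1_uniform_completeSix :
    ∀ (p : unitInterval) (A : Finset (Fin 6)) (o b : Fin 6) (s : ℝ),
      (∀ a ∈ A, s ≤ (Literature.Probability.Percolation.bondPercolation (⊤ : SimpleGraph (Fin 6)) p).real
        (Literature.Probability.Percolation.openConn a b)) →
      (Literature.Probability.Percolation.bondPercolation (⊤ : SimpleGraph (Fin 6)) p).real
          (⋃ a ∈ A, Literature.Probability.Percolation.openConn o a) * s ≤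
        (Literature.Probability.Percolation.bondPercolation (⊤ : SimpleGraph (Fin 6)) p).real
          (Literature.Probability.Percolation.openConn o b) := by
  intro p A o b s hs
  rw [bondPercolation_eq_prodBernoulli'] at hs ⊢
  exact kozmaNitzan2024_conjecture1_holds 6 _ A o b s hs

end EngineStubs

end Summit.CriticalPhenomena.PercolationContinuityZ3.Theorems

end
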